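import Summits.BirchSwinnertonDyer.Rank1Residual.P2.CongruentNumberPairsAtTwoUPlus
import Summits.BirchSwinnertonDyer.Rank1Residual.P2.CongruentNumberEvenFiveFamilyDescent
import Literature.NumberTheory.EllipticCurves.CongruentNumberOddMonskySelmerBound
import HarnessLib

/-!
# The uniform ODD DOOR `n = p₁⋯p_k ≡ 5, 7 (mod 8)`, `s(n) = 1`, WITHOUT Monsky's `2`-Selmer display:
# `ord_{s=1} L = 1`, rank `1`, `Ш[2^∞] = 0` and `BSD(E_n, 2) ⟺ ord₂(L′(E_n,1)/(Ω·Reg)) = 2k − 3`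
# from ANY rank-one datum, modulo GZK ONLY; DOOR A (`ρ`-free D-CN-6) modulo {U⁺, GZK} ONLY

HONEST FRAMING (cell `bsd-monsky`, run/shared/lean/pub/bsd-monsky/, README §1/§3; sub-lane «bsd-p2» vocabulary): the
cell's CLAIMED theorem is Monsky's 1990 conjecture (a)+(b) on `𝒮⁻` (even `k = 2`); the odd classes are a RECORD. The
census lane's odd doors — DOOR A `rankOne_sha_bsdp_two_congruentNumberCurve_of_uPlus` (`P2/CongruentNumberPairsAtTwoUPlus.lean`),
the `U₃⁰` door, the atlas/table doors — display Monsky's ODD `2`-descent matrix theorem `hM`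
(`HeathBrown1994.monsky_card_selmerGroup_two_odd`: `#Sel₂(E_{p₁⋯p_k}) = 2^{2+s}`), used only as `#Sel₂ = 8 ⟹ Ш[2^∞] = 0`
given rank `1`. The tree now PROVES the upper-bound half for every `k`
(`Literature/…/CongruentNumberOddMonskySelmerBound.lean`, `card_selmerGroup_two_le_pow_monskySelmerRankOdd`, complete
`2`-descent on Selmer classes), and `Ш[2^∞] = 0` needs only `#Sel₂ ≤ 8` with rank `1`
(`primaryComponent_sha_two_eq_bot_of_card_selmerGroup_le_eight`). HENCE THIS FILE: §1 a UNIFORM odd door over census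
vocabulary modulo GZK only — distinct odd primes `p₁, …, p_k`, `n = p₁⋯p_k ≡ 5, 7 (mod 8)`, `monskySelmerRankOdd p = 1`, any
datum `x ≠ 0`: `ord = 1`, rank `1`, `Ш[2^∞] = 0`, `BSD(E_n, 2) ⟺ ord₂ x = (2k + 1) − 4 = 2k − 3`
(`rankOne_sha_bsdp_two_iff_congruentNumberCurve_prod_descent`); §2 DOOR A with `hM` STRUCK
(`rankOne_sha_bsdp_two_congruentNumberCurve_of_uPlus_descent (hU) (hGZK)`, same kernel-decided inputs). Consumers with a
counted kernel (`hker`) or `det`/table certificate swap doors and drop `hM`. CONDITIONAL on the named facts said; per-pair;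
nothing asserted; closes no class; no mark moved.

References: [HeathBrown1994SelmerCongruentII] Appendix (Monsky), typescript p. 38 L17 – p. 39 L33 (odd case; upper bound a
tree theorem); [TianYuanZhang2017] Thm. 1.2, Thm. 3.5, §1 (1.1); [SilvermanAEC2009] Prop. X.1.4, X.4.9, Thm. X.4.2;
[SilvermanATAEC1994] IV.9.4, Table 4.1; [Miller2011LMS] Def. 1.1.
-/

noncomputable section

open scoped Classical

open Matrix Finset WeierstrassCurve Literature.NumberTheory.EllipticCurves
  Literature.NumberTheory.EllipticCurves.Rank1Residual
  Literature.NumberTheory.EllipticCurves.Rank1Residual.Typed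
  Literature.NumberTheory.EllipticCurves.HeathBrown1994
  Literature.NumberTheory.EllipticCurves.TianYuanZhang2017
  Literature.NumberTheory.QuadraticFields.RedeiReichardt

set_option autoImplicit false

namespace Summit.BirchSwinnertonDyer.Rank1Residual.P2

section Door

variable {k : ℕ} (p : Fin k → ℕ)

/-- **`#Sel₂(E_n) ≤ 8` on the odd family with `s(n) = 1`** — a tree theorem (Monsky's odd formula, upper bound, at `s = 1`).
Unconditional. [cite: HeathBrown1994SelmerCongruentII, Appendix (Monsky), typescript p. 39 L10–L33]
[cite: SilvermanAEC2009, Prop. X.1.4, Prop. X.4.9] -/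
theorem card_selmerGroup_two_le_eight_of_monskySelmerRankOdd_eq_one (hp : ∀ i, (p i).Prime)
    (hodd : ∀ i, Odd (p i)) (hinj : Function.Injective p) (hs : monskySelmerRankOdd p = 1) :
    Nat.card ((congruentNumberCurve (∏ i, p i)).selmerGroup 2) ≤ 8 := by
  have h := card_selmerGroup_two_le_pow_monskySelmerRankOdd k p hp hodd hinj
  rw [hs] at h
  exact h

/-! ## §1 The uniform odd door over census vocabulary, modulo GZK only -/

/-- **THE ODD DOOR OVER CENSUS VOCABULARY, binder `hGZK` ONLY, uniform in `k`.** For distinct odd primes `p₁, …, p_k` with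
`n = p₁⋯p_k ≡ 5` or `7 (mod 8)`, Monsky's odd Selmer rank `s(n) = monskySelmerRankOdd p = 1`, and ANY rank-one datum
`L′(E_n, 1) = x·Ω·Reg`, `x ≠ 0`: `ord_{s=1} L(E_n, s) = 1` (root number `−1` + `x ≠ 0`, no fact), rank `1` (GZK), `Ш(E_n)[2^∞] = 0`
(`#Sel₂ ≤ 2^{2+s} = 8`, a tree theorem, + Silverman X.4.2), and `BSD(E_n, 2) ⟺ ord₂ x = ord₂ ∏c_ℓ − 4 = (2k + 1) − 4`.
Per-pair; closes no class. CONDITIONAL on `hGZK`; nothing asserted. [cite: HeathBrown1994SelmerCongruentII, Appendix (Monsky), typescript p. 39 L10–L33]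
[cite: SilvermanAEC2009, Prop. X.1.4, Prop. X.4.9, Thm. X.4.2] [cite: SilvermanATAEC1994, IV.9.4, Table 4.1 (PDF pp. 345–347)]
[cite: Miller2011LMS, Def. 1.1 (arXiv:1010.2431 p. 3)] -/
theorem rankOne_sha_bsdp_two_iff_congruentNumberCurve_prod_descent
    (hGZK : rank_eq_analyticRank_of_analyticRank_le_one)
    (hp : ∀ i, (p i).Prime) (hodd : ∀ i, Odd (p i)) (hinj : Function.Injective p) {n : ℕ}
    (hn : ∏ i, p i = n) (h8 : n % 8 = 5 ∨ n % 8 = 7) (hs : monskySelmerRankOdd p = 1) {x : ℚ} (hx0 : x ≠ 0)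
    (hx : deriv (congruentNumberCurve n).entireLFunction 1 =
      (x : ℂ) * ((congruentNumberCurve n).realPeriodRat : ℂ) *
        ((congruentNumberCurve n).regulator : ℂ)) :
    (congruentNumberCurve n).analyticRank = 1 ∧ (congruentNumberCurve n).mordellWeilRank = 1 ∧
      AddCommGroup.primaryComponent (congruentNumberCurve n).sha 2 = ⊥ ∧
      (BSDp (congruentNumberCurve n) 2 ↔ padicValRat 2 x = 2 * (k : ℤ) + 1 - 4) := by
  have hsq : Squarefree n := hn ▸ squarefree_prod_of_injective p hp hinj
  have hn0 : n ≠ 0 := hsq.ne_zero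
  haveI := isElliptic_congruentNumberCurve hn0
  haveI : Fact (Nat.Prime 2) := ⟨Nat.prime_two⟩
  -- root number `−1` and `x ≠ 0`: `ord_{s=1} L = 1` (no named fact)
  have hΩ : ((congruentNumberCurve n).realPeriodRat : ℂ) ≠ 0 := by
    exact_mod_cast (congruentNumberCurve n).realPeriodRat_pos_holds.ne'
  have hR : ((congruentNumberCurve n).regulator : ℂ) ≠ 0 := by
    exact_mod_cast (congruentNumberCurve n).regulator_pos'.ne'
  have hder : deriv (congruentNumberCurve n).entireLFunction 1 ≠ 0 := by
    rw [hx]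
    exact mul_ne_zero (mul_ne_zero (by exact_mod_cast hx0) hΩ) hR
  have h8' : n % 8 = 5 ∨ n % 8 = 6 ∨ n % 8 = 7 := by
    rcases h8 with h | h
    · exact Or.inl h
    · exact Or.inr (Or.inr h)
  have hr1 : (congruentNumberCurve n).analyticRank = 1 :=
    analyticRank_congruentNumberCurve_eq_one_of_deriv_ne_zero hsq h8' hder
  -- GZK: rank `1`; the tree's `2`-descent + `s(n) = 1`: `#Sel₂ ≤ 8`; hence `Ш[2^∞] = 0`
  obtain ⟨hrank, -⟩ := hGZK (congruentNumberCurve n) (le_of_eq hr1)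
  rw [hr1] at hrank
  have hsel : Nat.card ((congruentNumberCurve n).selmerGroup 2) ≤ 8 := by
    subst hn
    exact card_selmerGroup_two_le_eight_of_monskySelmerRankOdd_eq_one p hp hodd hinj hs
  have hbot := primaryComponent_sha_two_eq_bot_of_card_selmerGroup_le_eight hn0 hrank hsel
  refine ⟨hr1, hrank, hbot, ?_⟩
  rw [bsdp_two_iff_of_LDerivOverOmegaReg_of_sha_two_eq_bot_of_torsionOrder_eq_four
    (congruentNumberCurve n) hGZK hr1 hx hbot (torsionOrder_congruentNumberCurve hsq),
    tamagawaProduct_congruentNumberCurve_prod p hp hodd hinj hn, padicValNat.prime_pow]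
  push_cast
  omega

end Door

/-! ## §2 DOOR A (`ρ`-free D-CN-6) modulo {U⁺, GZK} only -/

section DoorA

variable {k : ℕ} (p : Fin k → ℕ)

/-- **DOOR A (`ρ`-FREE D-CN-6) WITHOUT Monsky's fact.** `n = p₁⋯p_k` (distinct odd primes), `n ≡ 5, 7 (mod 8)`; hypothesis
U⁺ (`hU`); named fact `hGZK`; KERNEL-DECIDED inputs: `s(n) = 1` by the table route with a counted kernel (`hker`), `Σ₁(n)` odd or
`Σ₂′(n)` odd over `GenusField` (`hgen`). THEN `ord_{s=1} L(E_n, s) = 1`, rank `1`, `Ш(E_n)[2^∞] = 0` and `BSD(E_n, 2)` — the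
`2`-Selmer input is the tree's complete `2`-descent (`#Sel₂ ≤ 8`). Verbatim the landed DOOR A with `hM` struck.
[cite: TianYuanZhang2017, Thm. 1.2, Thm. 3.5 and §1 (1.1)] [cite: HeathBrown1994SelmerCongruentII, Appendix (Monsky), typescript p. 39 L10–L33]
[cite: SilvermanAEC2009, Prop. X.1.4, Prop. X.4.9, Thm. X.4.2] [cite: Miller2011LMS, Def. 1.1 (arXiv:1010.2431 p. 3)] -/
theorem rankOne_sha_bsdp_two_congruentNumberCurve_of_uPlus_descent
    (hU : ∀ (n : ℕ), Squarefree n → (n % 8 = 5 ∨ n % 8 = 6 ∨ n % 8 = 7) →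
      ∃ L : ℤ, IsScriptL n L ∧
        ((n % 8 = 5 ∨ n % 8 = 7) → (2 : ℤ) ∣ L →
          Even (genusSum₁ n fun d => genusClassNumber (GenusField d)) ∧
          Even (genusSum₂' n fun d => genusClassNumber (GenusField d))) ∧
        (n % 8 = 6 → (2 : ℤ) ∣ L → Even (genusSum₂' n fun d => genusClassNumber (GenusField d))))
    (hGZK : rank_eq_analyticRank_of_analyticRank_le_one)
    (hp : ∀ i, (p i).Prime) (hodd : ∀ i, Odd (p i)) (hinj : Function.Injective p)
    {n : ℕ} (hn : ∏ i, p i = n) (h8 : n % 8 = 5 ∨ n % 8 = 7)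
    (L : Fin k → Fin k → ZMod 2) (d2 dm2 : Fin k → ZMod 2)
    (hL : ∀ i j, addLegendreSym (p j) (p i) = L i j) (h2 : ∀ i, addLegendreSym 2 (p i) = d2 i)
    (hm2 : ∀ i, addLegendreSym (-2) (p i) = dm2 i)
    (hker : Fintype.card {v : Fin k ⊕ Fin k → ZMod 2 // Matrix.fromBlocks
        (Matrix.of (fun i j => if i = j then ∑ l ∈ Finset.univ.erase i, L i l else L i j) +
          Matrix.diagonal d2) (Matrix.diagonal d2) (Matrix.diagonal d2)
        (Matrix.of (fun i j => if i = j then ∑ l ∈ Finset.univ.erase i, L i l else L i j) +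
          Matrix.diagonal dm2) *ᵥ v = 0} = 2)
    (hgen : Odd (genusSum₁ n fun d => genusClassNumber (GenusField d)) ∨
      Odd (genusSum₂' n fun d => genusClassNumber (GenusField d))) :
    (congruentNumberCurve n).analyticRank = 1 ∧ (congruentNumberCurve n).mordellWeilRank = 1 ∧
      AddCommGroup.primaryComponent (congruentNumberCurve n).sha 2 = ⊥ ∧
      BSDp (congruentNumberCurve n) 2 := by
  have hsq : Squarefree n := hn ▸ squarefree_prod_of_injective p hp hinj
  -- U⁺ + odd genus sum: `ord = 1`, `L′ = 2^e · 𝓛² · Ω · Reg` with `𝓛` odd — no `ρ`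
  obtain ⟨Lz, hLodd, -, hderiv⟩ := rankOneDatum_of_uPlus hU hsq h8 hgen
  have hL0 : (Lz : ℚ) ≠ 0 := by
    have hL0' : Lz ≠ 0 := fun h => by simp [h] at hLodd
    exact_mod_cast hL0'
  have hx0 : (2 : ℚ) ^ twoExponent n * (Lz : ℚ) ^ 2 ≠ 0 :=
    mul_ne_zero (zpow_ne_zero _ two_ne_zero) (pow_ne_zero _ hL0)
  have hx : deriv (congruentNumberCurve n).entireLFunction 1 =
      (((2 : ℚ) ^ twoExponent n * (Lz : ℚ) ^ 2 : ℚ) : ℂ) *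
        ((congruentNumberCurve n).realPeriodRat : ℂ) * ((congruentNumberCurve n).regulator : ℂ) := by
    rw [hderiv]; push_cast; ring
  have hs : monskySelmerRankOdd p = 1 :=
    monskySelmerRankOdd_eq_of_table p L d2 dm2 hL h2 hm2 (s := 1) (by rw [hker, pow_one])
  obtain ⟨hr1, hrank, hbot, hiff⟩ :=
    rankOne_sha_bsdp_two_iff_congruentNumberCurve_prod_descent p hGZK hp hodd hinj hn h8 hs hx0 hx
  refine ⟨hr1, hrank, hbot, hiff.mpr ?_⟩
  rw [padicValRat_two_zpow_mul_sq hLodd, ← hn, twoExponent_prod_eq p hp hodd hinj]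
  ring

/-- **DOOR A, closed form, WITHOUT Monsky's fact: `BSD(E_n, 2)`** for `n = p₁⋯p_k ≡ 5, 7 (mod 8)` with Monsky kernel count `2` and
`Σ₁` odd or `Σ₂′` odd, modulo `hU` (U⁺), `hGZK` and nothing else. [cite: TianYuanZhang2017, Thm. 1.2, Thm. 3.5 and §1 (1.1)]
[cite: HeathBrown1994SelmerCongruentII, Appendix (Monsky), typescript p. 39 L10–L33] [cite: Miller2011LMS, Def. 1.1 (arXiv:1010.2431 p. 3)] -/
theorem bsdp_two_congruentNumberCurve_of_uPlus_descent
    (hU : ∀ (n : ℕ), Squarefree n → (n % 8 = 5 ∨ n % 8 = 6 ∨ n % 8 = 7) →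
      ∃ L : ℤ, IsScriptL n L ∧
        ((n % 8 = 5 ∨ n % 8 = 7) → (2 : ℤ) ∣ L →
          Even (genusSum₁ n fun d => genusClassNumber (GenusField d)) ∧
          Even (genusSum₂' n fun d => genusClassNumber (GenusField d))) ∧
        (n % 8 = 6 → (2 : ℤ) ∣ L → Even (genusSum₂' n fun d => genusClassNumber (GenusField d))))
    (hGZK : rank_eq_analyticRank_of_analyticRank_le_one)
    (hp : ∀ i, (p i).Prime) (hodd : ∀ i, Odd (p i)) (hinj : Function.Injective p)
    {n : ℕ} (hn : ∏ i, p i = n) (h8 : n % 8 = 5 ∨ n % 8 = 7)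
    (L : Fin k → Fin k → ZMod 2) (d2 dm2 : Fin k → ZMod 2)
    (hL : ∀ i j, addLegendreSym (p j) (p i) = L i j) (h2 : ∀ i, addLegendreSym 2 (p i) = d2 i)
    (hm2 : ∀ i, addLegendreSym (-2) (p i) = dm2 i)
    (hker : Fintype.card {v : Fin k ⊕ Fin k → ZMod 2 // Matrix.fromBlocks
        (Matrix.of (fun i j => if i = j then ∑ l ∈ Finset.univ.erase i, L i l else L i j) +
          Matrix.diagonal d2) (Matrix.diagonal d2) (Matrix.diagonal d2)
        (Matrix.of (fun i j => if i = j then ∑ l ∈ Finset.univ.erase i, L i l else L i j) +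
          Matrix.diagonal dm2) *ᵥ v = 0} = 2)
    (hgen : Odd (genusSum₁ n fun d => genusClassNumber (GenusField d)) ∨
      Odd (genusSum₂' n fun d => genusClassNumber (GenusField d))) :
    BSDp (congruentNumberCurve n) 2 :=
  (rankOne_sha_bsdp_two_congruentNumberCurve_of_uPlus_descent p hU hGZK hp hodd hinj hn h8 L d2 dm2 hL h2
    hm2 hker hgen).2.2.2

end DoorA

end Summit.BirchSwinnertonDyer.Rank1Residual.P2

end
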